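import Literature.ComputerArithmetic.Shewchuk1997.Distillation
import Summits.Ventures.CertifiedArithmetic.Expansions.Orient2dBlocks
import Summits.Ventures.CertifiedArithmetic.Expansions.WeakExpansionScale
import Mathlib.Tactic.Linarith
import Mathlib.Tactic.NormNum

/-!
# Weakly nonoverlapping expansions, part 11 (§15): distillation with FAST-EXPANSION-SUM

HONEST FRAMING (ENGINES group, unit `eng-quad-4`, kernels lane of the `certquad` engine — shared
numerical engines serving client cells; rigour lives in the verifiers; every published number
belongs to a client cell's ledger, not to the engines group): NEW WORK of the lane's Lean line, not
a published result, hence under `Summits/Ventures/` with no citation tag; nothing here is cited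
anywhere as a literature fact.  Parts 1–10 (`WeakExpansion*.lean`: the class W =
`IsWeakExpansion`, Theorems 1–2 on FAST-EXPANSION-SUM, Theorems 3–5 on SCALE-EXPANSION,
GROW-EXPANSION, EXPANSION-SUM) and
`Orient2dBlocks.lean` (`zeroElim`, `fastExpansionSumZeroElim`) precede; the distillation trees are
those of `Literature/ComputerArithmetic/Shewchuk1997/Distillation.lean` ([Shewchuk1997] §2.8).

THE QUESTION.  [Shewchuk1997] §2.8 recommends distilling (summing many expansions through a tree,
Fig. 16) with FAST-EXPANSION-SUM and zero elimination: "A well-balanced tree will yield an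
`O(k log k)` distillation algorithm ... it is usually fastest to use an unrolled EXPANSION-SUM to
create expansions of length four, and FAST-EXPANSION-SUM with zero elimination to sum these
expansions."
A distillation tree feeds the OUTPUT of one FAST-EXPANSION-SUM call to the next, so it needs a class
of expansions that FAST-EXPANSION-SUM maps into itself.  The paper's Theorem 13 would supply
"strongly nonoverlapping → strongly nonoverlapping" under round-to-even, but that conclusion is
false (`FastExpansionSumCounterexample.lean`; ERRATUM in the Literature file
`FastExpansionSum.lean`), and
"nonoverlapping" is not preserved either (Shewchuk's own §2.4 example).  The Literature file
`Distillation.lean` therefore proves distillation correct for EXPANSION-SUM only and lists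
FAST-EXPANSION-SUM distillation as not covered.

THE ANSWER (this file, 0 sorry).  The class W closes the gap: by Theorems 1–2 of this development
(`fastExpansionSum_isWeakExpansion`, `fastExpansionSum_nonoverlapping_of_isWeakExpansion`; `p ≥ 4`,
any round-to-nearest whose roundoff is 2-below its result — `RoundoffBelow 2`, e.g. IEEE
round-half-even) FAST-EXPANSION-SUM maps two W-expansions of floats to a W-expansion of floats with
the exact sum, so the generic distillation theorem of the Literature file applies with `P = W`:
* `distill_fastExpansionSum_spec` — for EVERY distillation tree whose leaves are W-expansions of
  floats (in particular single `p`-bit values, or strongly nonoverlapping / nonadjacent expansions),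
  distilling with FAST-EXPANSION-SUM gives a W-expansion — hence a nonoverlapping,
  increasing-except-zeros expansion (`IsExpansion 1`) — of floats with the exact sum of the addends
  and all `width` components; `…_roundTiesEven` for IEEE round-half-even.
* `distill_fastExpansionSumZeroElim_spec` — the same WITH ZERO ELIMINATION at every node (the
  configuration the paper recommends and `predicates.c` uses): W-expansion of floats, exact sum,
  nonempty, at most `width` components when every leaf is nonempty.
* `distillValuesFast`, `distillValuesFast_spec` — distillation of `k` `p`-bit values through the
  balanced tree with FAST-EXPANSION-SUM and zero elimination: a W-expansion of at most `k` floats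
  summing to `Σ xᵢ` (nonempty when `k ≥ 1`).
* `expansionProductFast`, `expansionProductFast_spec` — the PRODUCT of two expansions the
  recommended way (SCALE-EXPANSION of `e` by each `fᵢ`, then the balanced tree with
  FAST-EXPANSION-SUM and zero elimination): for `e ∈ W` and the `fᵢ` under the hypotheses of
  Theorem 3 (`scaleExpansion_isWeakExpansion` = the paper's Theorem 19 hypotheses), a W-expansion
  of floats with sum `(Σ e)(Σ f)` and at most `2mn` components.
SCOPE.  `p ≥ 4` and `RoundoffBelow 2` are the hypotheses of Theorem 2 (closure); under
round-half-away the closure already fails for GROW-EXPANSION (part 9), and Appendix A of the paper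
shows no tie-rule-independent class can work for FAST-EXPANSION-SUM.  Running-time claims
(`O(k log k)`) are not formalised.
-/

namespace Summit.Ventures.CertifiedArithmetic.Expansions

open Literature.ComputerArithmetic.JeannerodRump2018
open Literature.ComputerArithmetic.BoldoJeannerodMelquiondMuller2023 hiding twoSum twoSum_fst isFloat_twoSum
open Literature.ComputerArithmetic.Shewchuk1997

variable {p : ℕ} {emin : ℤ} {fl : ℚ → ℚ}

/-! ### §15.1  FAST-EXPANSION-SUM distillation on the class W -/

/-- A one-component expansion is weakly nonoverlapping. -/
theorem isWeakExpansion_singleton (x : ℚ) : IsWeakExpansion [x] :=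
  isWeakExpansion_cons.mpr ⟨fun _ h => absurd h (by simp), List.Pairwise.nil, isWeakExpansion_nil⟩

/-- **DISTILLATION WITH FAST-EXPANSION-SUM IS SOUND ON W** (`p ≥ 4`, any round-to-nearest with
`RoundoffBelow 2`, ANY tree): if every leaf is a weakly nonoverlapping expansion of floats, the
distilled result is a weakly nonoverlapping expansion of floats — in particular nonoverlapping and
increasing except for zeros — with the exact sum of the addends and `width` components. -/
theorem distill_fastExpansionSum_spec (hp : 4 ≤ p) (hfl : IsRoundNearest p emin fl)
    (hfl2 : RoundoffBelow 2 fl) (t : DistillTree) (hF : ∀ e ∈ t.leaves, ∀ x ∈ e, IsFloat p emin x)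
    (hW : ∀ e ∈ t.leaves, IsWeakExpansion e) :
    IsWeakExpansion (t.distill (fastExpansionSum fl)) ∧
      IsExpansion 1 (t.distill (fastExpansionSum fl)) ∧
      (t.distill (fastExpansionSum fl)).sum = (t.leaves.map List.sum).sum ∧
      (t.distill (fastExpansionSum fl)).length = t.width ∧
      ∀ x ∈ t.distill (fastExpansionSum fl), IsFloat p emin x := by
  let P : List ℚ → Prop := fun e => (∀ x ∈ e, IsFloat p emin x) ∧ IsWeakExpansion e
  have hadd : ∀ e f, P e → P f → P (fastExpansionSum fl e f) := fun e f he hf =>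
    ⟨(fastExpansionSum_nonoverlapping_of_isWeakExpansion hp hfl he.1 he.2 hf.1 hf.2).2.2.2,
      fastExpansionSum_isWeakExpansion hp hfl hfl2 he.1 he.2 hf.1 hf.2⟩
  have hsum : ∀ e f, P e → P f → (fastExpansionSum fl e f).sum = e.sum + f.sum := fun e f he hf =>
    (fastExpansionSum_nonoverlapping_of_isWeakExpansion hp hfl he.1 he.2 hf.1 hf.2).2.1
  have hlen : ∀ e f, P e → P f → (fastExpansionSum fl e f).length = e.length + f.length :=
    fun e f he hf =>
    (fastExpansionSum_nonoverlapping_of_isWeakExpansion hp hfl he.1 he.2 hf.1 hf.2).2.2.1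
  have hl : ∀ e ∈ t.leaves, P e := fun e he => ⟨hF e he, hW e he⟩
  have hP := DistillTree.distill_induction hadd t hl
  exact ⟨hP.2, hP.2.isExpansion, DistillTree.sum_distill hadd hsum t hl,
    DistillTree.length_distill_of hadd hlen t hl, hP.1⟩

/-- The IEEE round-half-even instance of `distill_fastExpansionSum_spec`. -/
theorem distill_fastExpansionSum_spec_roundTiesEven (hp : 4 ≤ p) (t : DistillTree)
    (hF : ∀ e ∈ t.leaves, ∀ x ∈ e, IsFloat p emin x) (hW : ∀ e ∈ t.leaves, IsWeakExpansion e) :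
    IsWeakExpansion (t.distill (fastExpansionSum (roundTiesEven p emin))) ∧
      IsExpansion 1 (t.distill (fastExpansionSum (roundTiesEven p emin))) ∧
      (t.distill (fastExpansionSum (roundTiesEven p emin))).sum = (t.leaves.map List.sum).sum ∧
      (t.distill (fastExpansionSum (roundTiesEven p emin))).length = t.width ∧
      ∀ x ∈ t.distill (fastExpansionSum (roundTiesEven p emin)), IsFloat p emin x :=
  distill_fastExpansionSum_spec hp (isRoundNearest_roundTiesEven (le_trans (by norm_num) hp))
    (roundoffBelow_two_roundTiesEven p emin) t hF hW

/-! ### §15.2  With zero elimination at every node -/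

/-- **DISTILLATION WITH FAST-EXPANSION-SUM AND ZERO ELIMINATION** (the recommended configuration):
for every tree with W-expansion leaves of floats, the result is a NONEMPTY weakly nonoverlapping
expansion of floats with the exact sum, whose components are all nonzero unless it is `⟨0⟩`. -/
theorem distill_fastExpansionSumZeroElim_spec (hp : 4 ≤ p) (hfl : IsRoundNearest p emin fl)
    (hfl2 : RoundoffBelow 2 fl) (t : DistillTree) (hF : ∀ e ∈ t.leaves, ∀ x ∈ e, IsFloat p emin x)
    (hW : ∀ e ∈ t.leaves, IsWeakExpansion e) :
    IsWeakExpansion (t.distill (fastExpansionSumZeroElim fl)) ∧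
      IsExpansion 1 (t.distill (fastExpansionSumZeroElim fl)) ∧
      (t.distill (fastExpansionSumZeroElim fl)).sum = (t.leaves.map List.sum).sum ∧
      ∀ x ∈ t.distill (fastExpansionSumZeroElim fl), IsFloat p emin x := by
  let P : List ℚ → Prop := fun e => (∀ x ∈ e, IsFloat p emin x) ∧ IsWeakExpansion e
  have hadd : ∀ e f, P e → P f → P (fastExpansionSumZeroElim fl e f) := fun e f he hf =>
    let h := fastExpansionSumZeroElim_spec hp hfl hfl2 he.1 he.2 hf.1 hf.2
    ⟨h.2.2.1, h.1⟩
  have hsum : ∀ e f, P e → P f → (fastExpansionSumZeroElim fl e f).sum = e.sum + f.sum :=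
    fun e f he hf => (fastExpansionSumZeroElim_spec hp hfl hfl2 he.1 he.2 hf.1 hf.2).2.1
  have hl : ∀ e ∈ t.leaves, P e := fun e he => ⟨hF e he, hW e he⟩
  have hP := DistillTree.distill_induction hadd t hl
  exact ⟨hP.2, hP.2.isExpansion, DistillTree.sum_distill hadd hsum t hl, hP.1⟩

/-- With zero elimination the expansions only get shorter: if every leaf is a NONEMPTY
W-expansion of floats, every node of the tree computes a nonempty expansion of at most `width`
components. -/
theorem length_distill_fastExpansionSumZeroElim_le (hp : 4 ≤ p) (hfl : IsRoundNearest p emin fl)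
    (hfl2 : RoundoffBelow 2 fl) :
    ∀ t : DistillTree, (∀ e ∈ t.leaves, ∀ x ∈ e, IsFloat p emin x) →
      (∀ e ∈ t.leaves, IsWeakExpansion e) → (∀ e ∈ t.leaves, e ≠ []) →
      t.distill (fastExpansionSumZeroElim fl) ≠ [] ∧
        (t.distill (fastExpansionSumZeroElim fl)).length ≤ t.width
  | DistillTree.leaf e, _, _, h => ⟨by simpa using h, by simp⟩
  | DistillTree.node l r, hF, hW, h => by
    have hFl : ∀ e ∈ l.leaves, ∀ x ∈ e, IsFloat p emin x := fun e he => hF e (by simp [he])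
    have hFr : ∀ e ∈ r.leaves, ∀ x ∈ e, IsFloat p emin x := fun e he => hF e (by simp [he])
    have hWl : ∀ e ∈ l.leaves, IsWeakExpansion e := fun e he => hW e (by simp [he])
    have hWr : ∀ e ∈ r.leaves, IsWeakExpansion e := fun e he => hW e (by simp [he])
    obtain ⟨hl0, hl⟩ := length_distill_fastExpansionSumZeroElim_le hp hfl hfl2 l hFl hWl
      fun e he => h e (by simp [he])
    obtain ⟨-, hr⟩ := length_distill_fastExpansionSumZeroElim_le hp hfl hfl2 r hFr hWr
      fun e he => h e (by simp [he])
    obtain ⟨hWL, -, -, hFL⟩ := distill_fastExpansionSumZeroElim_spec hp hfl hfl2 l hFl hWl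
    obtain ⟨hWR, -, -, hFR⟩ := distill_fastExpansionSumZeroElim_spec hp hfl hfl2 r hFr hWr
    rw [DistillTree.distill_node, DistillTree.width_node]
    set L := l.distill (fastExpansionSumZeroElim fl)
    set R := r.distill (fastExpansionSumZeroElim fl)
    refine ⟨zeroElim_ne_nil _, ?_⟩
    have hle := length_zeroElim_le (fastExpansionSum fl L R)
    rw [(fastExpansionSum_nonoverlapping_of_isWeakExpansion hp hfl hFL hWL hFR hWR).2.2.1] at hle
    have h1 : 1 ≤ L.length := List.length_pos_of_ne_nil hl0
    have hmax : max (L.length + R.length) 1 = L.length + R.length := max_eq_left (by omega)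
    rw [hmax] at hle
    unfold fastExpansionSumZeroElim
    omega

/-! ### §15.3  Distillation of `k` values with FAST-EXPANSION-SUM and zero elimination -/

/-- DISTILLATION OF `k` `p`-BIT VALUES through the balanced tree of
`Shewchuk1997/Distillation.lean`, with FAST-EXPANSION-SUM and zero elimination at every node. -/
def distillValuesFast (fl : ℚ → ℚ) (xs : List ℚ) : List ℚ :=
  (DistillTree.balanced (xs.map fun x => [x])).distill (fastExpansionSumZeroElim fl)

/-- **`k` VALUES DISTIL TO A W-EXPANSION** (`p ≥ 4`, `RoundoffBelow 2` round-to-nearest): weakly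
nonoverlapping (so nonoverlapping), floats, exact sum, nonempty for `k ≥ 1`, at most `k`
components. -/
theorem distillValuesFast_spec (hp : 4 ≤ p) (hfl : IsRoundNearest p emin fl)
    (hfl2 : RoundoffBelow 2 fl) {xs : List ℚ} (hxs : ∀ x ∈ xs, IsFloat p emin x) :
    IsWeakExpansion (distillValuesFast fl xs) ∧ IsExpansion 1 (distillValuesFast fl xs) ∧
      (distillValuesFast fl xs).sum = xs.sum ∧ (∀ x ∈ distillValuesFast fl xs, IsFloat p emin x) ∧
      (xs ≠ [] → distillValuesFast fl xs ≠ []) ∧ (distillValuesFast fl xs).length ≤ xs.length := by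
  unfold distillValuesFast
  by_cases h0 : xs = []
  · subst h0
    simp [isWeakExpansion_nil, isExpansion_nil]
  · have hl := leaves_balanced_values xs h0
    set t := DistillTree.balanced (xs.map fun x => [x]) with ht
    have hF : ∀ e ∈ t.leaves, ∀ x ∈ e, IsFloat p emin x := fun e he => by
      rw [hl] at he
      obtain ⟨x, hx, rfl⟩ := List.mem_map.mp he
      simpa using hxs x hx
    have hW : ∀ e ∈ t.leaves, IsWeakExpansion e := fun e he => by
      rw [hl] at he
      obtain ⟨x, _, rfl⟩ := List.mem_map.mp he
      exact isWeakExpansion_singleton x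
    have hne : ∀ e ∈ t.leaves, e ≠ [] := fun e he => by
      rw [hl] at he
      obtain ⟨x, _, rfl⟩ := List.mem_map.mp he
      simp
    obtain ⟨hWt, hEt, hSt, hFt⟩ := distill_fastExpansionSumZeroElim_spec hp hfl hfl2 t hF hW
    obtain ⟨hnt, hLt⟩ := length_distill_fastExpansionSumZeroElim_le hp hfl hfl2 t hF hW hne
    refine ⟨hWt, hEt, ?_, hFt, fun _ => hnt, ?_⟩
    · rw [hSt, hl, List.map_map]
      have : (List.sum ∘ fun x : ℚ => [x]) = id := by funext x; simp
      rw [this, List.map_id]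
    · have hw : t.width = xs.length := by
        rw [DistillTree.width_eq_sum_length, hl, List.map_map]
        have : ((List.length ∘ fun x : ℚ => [x]) : ℚ → ℕ) = fun _ => 1 := by funext x; simp
        rw [this, List.map_const', List.sum_replicate, smul_eq_mul, mul_one]
      rwa [hw] at hLt

/-- The IEEE round-half-even instance of `distillValuesFast_spec`. -/
theorem distillValuesFast_spec_roundTiesEven (hp : 4 ≤ p) {xs : List ℚ}
    (hxs : ∀ x ∈ xs, IsFloat p emin x) :
    IsWeakExpansion (distillValuesFast (roundTiesEven p emin) xs) ∧
      IsExpansion 1 (distillValuesFast (roundTiesEven p emin) xs) ∧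
      (distillValuesFast (roundTiesEven p emin) xs).sum = xs.sum ∧
      (∀ x ∈ distillValuesFast (roundTiesEven p emin) xs, IsFloat p emin x) ∧
      (xs ≠ [] → distillValuesFast (roundTiesEven p emin) xs ≠ []) ∧
      (distillValuesFast (roundTiesEven p emin) xs).length ≤ xs.length :=
  distillValuesFast_spec hp (isRoundNearest_roundTiesEven (le_trans (by norm_num) hp))
    (roundoffBelow_two_roundTiesEven p emin) hxs

/-! ### §15.4  Products of W-expansions with FAST-EXPANSION-SUM and zero elimination -/

/-- EXPANSION PRODUCT ON W, the recommended way ([Shewchuk1997] §2.8: SCALE-EXPANSION, then a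
distillation tree with FAST-EXPANSION-SUM and zero elimination): SCALE-EXPANSION of `e` by each
component of `f` (zeros kept at the leaves — the first node eliminates them), then the balanced
tree of `Shewchuk1997/Distillation.lean` with `fastExpansionSumZeroElim` at every node. -/
def expansionProductFast (tp : ℚ → ℚ → ℚ × ℚ) (fl : ℚ → ℚ) (e f : List ℚ) : List ℚ :=
  (DistillTree.balanced (f.map fun b => scaleExpansion tp fl e b)).distill
    (fastExpansionSumZeroElim fl)

/-- **THE W PRODUCT IS CORRECT** (`p ≥ 4`, round-to-nearest with `RoundoffBelow 2`): for a weakly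
nonoverlapping `e` of floats and components `fᵢ` under the hypotheses of Theorem 3 of this
development (= the paper's Theorem 19: `fᵢ = Mᵢ·2^kᵢ` with `|Mᵢ| < 2^p`, the components of `e`
representable `p`-bit numbers above `2^(emin − kᵢ)`, the two-product exact on `e × fᵢ`), the result
is a weakly nonoverlapping — hence nonoverlapping — expansion of floats with sum `(Σ e)(Σ f)`, of
at most `2mn` components when `e` is nonempty. -/
theorem expansionProductFast_spec (hp : 4 ≤ p) (hfl : IsRoundNearest p emin fl)
    (hfl2 : RoundoffBelow 2 fl) {tp : ℚ → ℚ → ℚ × ℚ} {e f : List ℚ}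
    (he : ∀ x ∈ e, IsFloat p emin x) (hexp : IsWeakExpansion e)
    (hf : ∀ b ∈ f, ∃ Mb kb : ℤ, b = (Mb : ℚ) * 2 ^ kb ∧ |Mb| < (2 : ℤ) ^ p ∧
      ∀ x ∈ e, IsFloat p (emin - kb) x)
    (htp : ∀ b ∈ f, ∀ x ∈ e, (tp x b).1 = fl (x * b) ∧ (tp x b).1 + (tp x b).2 = x * b) :
    IsWeakExpansion (expansionProductFast tp fl e f) ∧
      IsExpansion 1 (expansionProductFast tp fl e f) ∧
      (expansionProductFast tp fl e f).sum = e.sum * f.sum ∧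
      (∀ z ∈ expansionProductFast tp fl e f, IsFloat p emin z) ∧
      (e ≠ [] → (expansionProductFast tp fl e f).length ≤ 2 * e.length * f.length) := by
  unfold expansionProductFast
  by_cases h0 : f = []
  · subst h0
    simp [isWeakExpansion_nil, isExpansion_nil]
  · have hp1 : 1 ≤ p := le_trans (by norm_num) hp
    have hl := leaves_balanced_scaleExpansion tp fl e h0
    set t := DistillTree.balanced (f.map fun b => scaleExpansion tp fl e b) with ht
    have hleaf : ∀ b ∈ f, IsWeakExpansion (scaleExpansion tp fl e b) ∧
        (scaleExpansion tp fl e b).sum = e.sum * b ∧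
        (∀ z ∈ scaleExpansion tp fl e b, IsFloat p emin z) ∧
        (scaleExpansion tp fl e b).length = 2 * e.length := fun b hb => by
      obtain ⟨Mb, kb, hbrep, hMb, heU⟩ := hf b hb
      exact scaleExpansion_isWeakExpansion hp1 hfl hfl2 hbrep (by exact_mod_cast hMb) he heU hexp
        (htp b hb)
    have hF : ∀ l ∈ t.leaves, ∀ x ∈ l, IsFloat p emin x := fun l hl' => by
      rw [hl] at hl'
      obtain ⟨b, hb, rfl⟩ := List.mem_map.mp hl'
      exact (hleaf b hb).2.2.1
    have hW : ∀ l ∈ t.leaves, IsWeakExpansion l := fun l hl' => by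
      rw [hl] at hl'
      obtain ⟨b, hb, rfl⟩ := List.mem_map.mp hl'
      exact (hleaf b hb).1
    obtain ⟨hWt, hEt, hSt, hFt⟩ := distill_fastExpansionSumZeroElim_spec hp hfl hfl2 t hF hW
    refine ⟨hWt, hEt, ?_, hFt, fun he0 => ?_⟩
    · rw [hSt, hl, List.map_map]
      have : (f.map (List.sum ∘ fun b => scaleExpansion tp fl e b)) = f.map fun b => e.sum * b :=
        List.map_congr_left fun b hb => by simpa using (hleaf b hb).2.1
      rw [this, List.sum_map_mul_left, List.map_id']
    · have hne : ∀ l ∈ t.leaves, l ≠ [] := fun l hl' => by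
        rw [hl] at hl'
        obtain ⟨b, hb, rfl⟩ := List.mem_map.mp hl'
        have hlen := (hleaf b hb).2.2.2
        have hpos := List.length_pos_of_ne_nil he0
        intro hnil
        rw [hnil, List.length_nil] at hlen
        omega
      obtain ⟨-, hLt⟩ := length_distill_fastExpansionSumZeroElim_le hp hfl hfl2 t hF hW hne
      have hw : t.width = 2 * e.length * f.length := by
        rw [DistillTree.width_eq_sum_length, hl, List.map_map]
        have : (f.map (List.length ∘ fun b => scaleExpansion tp fl e b)) =
            f.map fun _ => 2 * e.length :=
          List.map_congr_left fun b hb => by simpa using (hleaf b hb).2.2.2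
        rw [this, List.map_const', List.sum_replicate, smul_eq_mul]
        ring
      rwa [hw] at hLt

/-- The IEEE round-half-even instance of `expansionProductFast_spec`. -/
theorem expansionProductFast_spec_roundTiesEven (hp : 4 ≤ p) {tp : ℚ → ℚ → ℚ × ℚ}
    {e f : List ℚ} (he : ∀ x ∈ e, IsFloat p emin x) (hexp : IsWeakExpansion e)
    (hf : ∀ b ∈ f, ∃ Mb kb : ℤ, b = (Mb : ℚ) * 2 ^ kb ∧ |Mb| < (2 : ℤ) ^ p ∧
      ∀ x ∈ e, IsFloat p (emin - kb) x)
    (htp : ∀ b ∈ f, ∀ x ∈ e, (tp x b).1 = roundTiesEven p emin (x * b) ∧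
      (tp x b).1 + (tp x b).2 = x * b) :
    IsWeakExpansion (expansionProductFast tp (roundTiesEven p emin) e f) ∧
      IsExpansion 1 (expansionProductFast tp (roundTiesEven p emin) e f) ∧
      (expansionProductFast tp (roundTiesEven p emin) e f).sum = e.sum * f.sum ∧
      (∀ z ∈ expansionProductFast tp (roundTiesEven p emin) e f, IsFloat p emin z) ∧
      (e ≠ [] →
        (expansionProductFast tp (roundTiesEven p emin) e f).length ≤ 2 * e.length * f.length) :=
  expansionProductFast_spec hp (isRoundNearest_roundTiesEven (le_trans (by norm_num) hp))
    (roundoffBelow_two_roundTiesEven p emin) he hexp hf htp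

end Summit.Ventures.CertifiedArithmetic.Expansions
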